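import Summits.ResolutionOfSingularities.Statement
import Literature.StrongHypotheses.ResolutionOfSingularities
import Literature.AlgebraicGeometry.Resolution.ExcellentRingsFieldProofs
import Summits.ResolutionOfSingularities.ResolutionOfSingularities.Theorems.ValuativePatchingRelBlowupResolution
import HarnessLib
import HarnessLib.Audit
import HarnessLib.Audit.TribunalTags

/-!
# Summit `ResolutionOfSingularities` — bridges of the Strong-Hypothesis Library (D-0034, skeleton)

Summit-side BRIDGE file for the registry `Literature/StrongHypotheses/ResolutionOfSingularities.lean`:
for every `H` tagged with `@[strong_hypothesis "ResolutionOfSingularities.ResolutionOfSingularities"]`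
exactly ONE bridge tagged `@[summit_bridge "ResolutionOfSingularities.ResolutionOfSingularities"]`,
concluding the ROOT problem decl `_root_.ResolutionOfSingularities`
(`Summits/ResolutionOfSingularities/ResolutionOfSingularities/Statement.lean`,
`:= Literature.AlgebraicGeometry.Resolution.ResolutionOfSingularities = ∀ p, p.Prime → ResolutionInChar.{0} p`,
unfolded by `ResolutionOfSingularities_iff`). Written with the `_root_` prefix so that no
namespace of the same name can capture the identifier.

* SUMMIT-SIDE NEW CLOSURE (1): `BlowupResolution := ∀ p, p.Prime → BlowupResolutionInChar.{0} p`
  — the `∀ p prime` closure of the PARAMETRISED summit-side conjecture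
  `Summit.ResolutionOfSingularities.ResolutionOfSingularities.BlowupResolutionInChar (p : ℕ)`
  (`Theorems/SandwichedSingularitiesResolution.lean`; a `Summits` module, so Literature cannot
  import it and the closure is stated here — it is the second of the summit's two new decls).
  LANDED bridge `blowupResolution_implies_resolutionOfSingularities` over
  `Theorems.resolutionInChar_of_blowupResolutionInChar` (`Theorems/ValuativePatchingRelBlowupResolution.lean`).
* LANDED bridge (1) for the Literature-side hypothesis: `quasiExcellentResolution_implies_resolutionOfSingularities`
  — a reduced separated scheme of finite type over a field is separated, Noetherian and
  quasi-excellent (`Scheme.isSeparated_of_isSeparated_over`, `Scheme.isNoetherian_of_finiteType_over_field`,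
  `Scheme.isQuasiExcellent_of_locallyOfFiniteType Stacks07QW_field_holds`, all in tree).
* PRINTED bridges: none.

No new mathematics is proved here; no `sorry`, no axiom.
-/

noncomputable section

open CategoryTheory AlgebraicGeometry

namespace Summit.ResolutionOfSingularities.StrongHypotheses

open Literature.AlgebraicGeometry.Resolution
open Literature.StrongHypotheses.ResolutionOfSingularities
open Summit.ResolutionOfSingularities.ResolutionOfSingularities (BlowupResolutionInChar)

/-! ## Strictly stronger hypotheses -/

/-- **Grothendieck's quasi-excellent resolution ⇒ the summit** (landed): a reduced separated
`k`-scheme of finite type is separated (`Scheme.isSeparated_of_isSeparated_over`), Noetherian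
(`Scheme.isNoetherian_of_finiteType_over_field`) and quasi-excellent (Stacks 07QW, discharged:
`Stacks07QW_field_holds`, via `Scheme.isQuasiExcellent_of_locallyOfFiniteType`).
[cite: StacksProject, Tag 07QW] -/
@[summit_bridge "ResolutionOfSingularities.ResolutionOfSingularities"]
theorem quasiExcellentResolution_implies_resolutionOfSingularities :
    QuasiExcellentResolution → _root_.ResolutionOfSingularities := by
  intro h p _ k _ _ X f hsep hft hqc hred
  haveI := hsep; haveI := hft; haveI := hqc; haveI := hred
  haveI : X.IsSeparated := Scheme.isSeparated_of_isSeparated_over f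
  haveI : IsNoetherian X := Scheme.isNoetherian_of_finiteType_over_field f
  exact h X (Scheme.isQuasiExcellent_of_locallyOfFiniteType Stacks07QW_field_holds f)

/-- OPEN CONJECTURE — **resolution by one blowing up, in every positive characteristic**: for
every prime `p`, every integral separated scheme of finite type `X` over a field of characteristic
`p` carries a non-zero ideal sheaf `I` whose blowing up `Bl_I X` is regular — the `∀ p prime`
closure of the parametrised summit-side conjecture `BlowupResolutionInChar p`
(`Theorems/SandwichedSingularitiesResolution.lean`). This is resolution in the FORMAT in which it is
proved where it is proved (Hironaka 1964, Main Theorem I: a composite of blowing ups with regular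
centres, and a composite of blowing ups of a variety is one blowing up; Cossart–Jannsen–Saito 2020,
Thm. 1.2, dimension `≤ 2` in all characteristics), i.e. PROJECTIVE resolution; open in dimension
`≥ 4` for `p` prime ("All of these problems are open in dimension four or more", Piltant 2013,
p. 2). STRICTLY STRONGER than the summit (a regular blowing up along a non-zero ideal of an
integral variety is proper and birational, and integral schemes suffice — bridge LANDED below;
the converse "every resolution is dominated by a blowing up with regular source" is not formal).
[cite: Piltant2013, p. 2 (open in dimension ≥ 4)] [status: open] -/
@[conjecture, strong_hypothesis "ResolutionOfSingularities.ResolutionOfSingularities"]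
def BlowupResolution : Prop :=
  ∀ p : ℕ, p.Prime → BlowupResolutionInChar.{0} p

/-- **Resolution by one blowing up ⇒ the summit** (landed): pointwise in `p`,
`Theorems.resolutionInChar_of_blowupResolutionInChar` (`Theorems/ValuativePatchingRelBlowupResolution.lean`:
reduce to integral schemes by `resolutionInChar_iff_integral`, then a regular blowing up along a
non-zero ideal is a resolution). [folklore] -/
@[summit_bridge "ResolutionOfSingularities.ResolutionOfSingularities"]
theorem blowupResolution_implies_resolutionOfSingularities :
    BlowupResolution → _root_.ResolutionOfSingularities :=
  fun h p hp =>
    Summit.ResolutionOfSingularities.ResolutionOfSingularities.Theorems.resolutionInChar_of_blowupResolutionInChar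
      (h p hp)

end Summit.ResolutionOfSingularities.StrongHypotheses
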